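import Mathlib
import Literature.Analysis.ValidatedNumerics.TaylorModelIntegralCertTrig
import Literature.Analysis.ValidatedNumerics.TaylorModelExpr
import Summits.Ventures.FusionMHD.Models.CerfonFreidbergIterLikeQHalfBoxes
import HarnessLib

/-!
# Ventures/FusionMHD — Models/CerfonFreidbergIterLikeQ90Boxes.lean: KERNEL BOX CERTIFICATES around the surface `ψ_N = 9/10`
# of THE Cerfon–Freidberg ITER-like instance — «flux below the level `U_a/10`» on the inner core `s ≤ s_A(θ)` and the second ray
# derivative bounded, `|∂_s D_r| ≤ M(θ)`, on the strip `s_A(θ) ≤ s ≤ s_max(θ)` containing the surface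
# (`ψ_N = 9/10` SIBLING of `Models/CerfonFreidbergIterLikeQHalfBoxes.lean`, ★ #117)

HONEST FRAMING (LADDER-GRIDFUSION three columns; CF rung, F2 item R2).  Per `t`-panel `j` (polar angle `θ ∈ [π⁻·2jh, π⁺·(2j+2)h]`,
`h = 1/64`): (B1) for `0 ≤ s ≤ s_A` the ray profile is BELOW the level, `U(X_a + s cos θ, s sin θ) − U(X_a,0)/10 ≤ −10⁻⁴`; (B2) for
`s_A ≤ s ≤ s_max` `|F2c| ≤ M`.  METHOD: (B1) needs a new 72-statement interval program `boxF` (the `ψ_N = 1/2` one with level constant `−1/10`,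
identification `boxF_toFunP` by `simp` + `ring`) and its box obligation `fOK`; everything else is the `ψ_N = 1/2` file's BY NAME —
`CFIterLike.QHalf.boxF2` / `f2OK` / `f2_abs_of_f2OK` (level-free), the SAME 11-parameter instance box `ibox` with `boxMem_ibox`, the grids
`cell` and the covering lemma `exists_cell`.  New records `BoxData` (+`ok`, +`sound`) for the `ψ_N = 9/10` strips (296 boxes decided in
`…Q90BoxesA/B.lean`; grids/claims from the float interval mimic `pub/gridfusion/models/gen-model-5/g7/mkboxes.py` with `PSIN = 9/10`,
confirmed by a compiled `#eval`).  MODELLED: analytic Cerfon–Freidberg family (ITER-like triple); nothing about a device or stability.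
No `native_decide`.  Typer/prover: gridfusion-model-5 (g8), 2026-08-27.
Citations: Freidberg 2014 §6.6.1 (6.153) [Freidberg2014]; Mahboubi–Melquiond–Sibut-Pinote 2016 §4.1 [MahboubiMelquiondSibutpinote2016].
-/

noncomputable section

open Set
open Literature.Analysis.ValidatedNumerics Literature.Analysis.ValidatedNumerics.PolyMP
open Literature.Analysis.ValidatedNumerics.NumericsMP Literature.Analysis.ValidatedNumerics.ExpPoly
open Literature.MathematicalPhysics.MHD Literature.MathematicalPhysics.MHD.CerfonFreidberg

set_option autoImplicit false

namespace Summit.Ventures.FusionMHD.Models.CFIterLike.Q90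

set_option maxRecDepth 100000

/-! ## §1 The (B1) box program for the level `U_a/10` and its closed form -/

/-- `U(X_a + s cos θ, s sin θ) − U_a/10` as a 72-statement program of interval parameters `c₀…c₆, X_a, U_a, θ, s`. -/
def boxF : TProg :=
  [TOp.cos 9, TOp.sin 10, TOp.base (SOp.mul 12 1), TOp.base (SOp.add 10 0), TOp.base (SOp.mul 14 2),
   TOp.base (SOp.log 1), TOp.base (SOp.mul 2 2), TOp.base (SOp.mul 2 2), TOp.base (SOp.poly [2]),
   TOp.base (SOp.mul 0 13), TOp.base (SOp.poly [8]), TOp.base (SOp.mul 0 17), TOp.base (SOp.mul 0 4),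
   TOp.base (SOp.add 3 0), TOp.base (SOp.mul 0 6), TOp.base (SOp.add 17 0), TOp.base (SOp.mul 0 8),
   TOp.base (SOp.add 17 0), TOp.base (SOp.poly [(-4)]), TOp.base (SOp.mul 0 22), TOp.base (SOp.poly [(-9)]),
   TOp.base (SOp.mul 0 25), TOp.base (SOp.add 2 0), TOp.base (SOp.mul 12 28), TOp.base (SOp.poly [(-140)]),
   TOp.base (SOp.mul 0 31), TOp.base (SOp.add 2 0), TOp.base (SOp.mul 0 19), TOp.base (SOp.add 5 0),
   TOp.base (SOp.mul 0 21), TOp.base (SOp.add 31 0), TOp.base (SOp.poly [(1 / 8)]), TOp.base (SOp.add 0 35),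
   TOp.base (SOp.poly [(-12)]), TOp.base (SOp.mul 0 39), TOp.base (SOp.poly [75]), TOp.base (SOp.mul 0 42),
   TOp.base (SOp.add 2 0), TOp.base (SOp.mul 0 30), TOp.base (SOp.add 6 0), TOp.base (SOp.mul 45 33),
   TOp.base (SOp.add 1 0), TOp.base (SOp.mul 0 35), TOp.base (SOp.add 12 0), TOp.base (SOp.mul 0 37),
   TOp.base (SOp.add 27 0), TOp.base (SOp.neg 48), TOp.base (SOp.mul 13 51), TOp.base (SOp.poly [(-120)]),
   TOp.base (SOp.mul 0 55), TOp.base (SOp.mul 0 42), TOp.base (SOp.add 3 0), TOp.base (SOp.mul 0 44),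
   TOp.base (SOp.add 6 0), TOp.base (SOp.poly [3]), TOp.base (SOp.mul 0 59), TOp.base (SOp.poly [180]),
   TOp.base (SOp.mul 0 63), TOp.base (SOp.mul 0 50), TOp.base (SOp.add 3 0), TOp.base (SOp.poly [(-15)]),
   TOp.base (SOp.mul 0 67), TOp.base (SOp.mul 0 55), TOp.base (SOp.add 3 0), TOp.base (SOp.mul 0 57),
   TOp.base (SOp.add 11 0), TOp.base (SOp.mul 0 59), TOp.base (SOp.mul 61 0), TOp.base (SOp.add 22 0),
   TOp.base (SOp.poly [(-1 / 10)]), TOp.base (SOp.mul 0 78), TOp.base (SOp.add 2 0)]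

/-- Identification of the `ψ_N = 9/10` program `boxF`. -/
theorem boxF_toFunP (c0 c1 c2 c3 c4 c5 c6 Xa' Ua' θ s t : ℝ) :
    CFIterLike.Q90.boxF.toFunP [c0, c1, c2, c3, c4, c5, c6, Xa', Ua', θ, s] t
      = cfSolution 0 ![c0, c1, c2, c3, c4, c5, c6] (Xa' + s * Real.cos θ) (s * Real.sin θ) - 1 / 10 * Ua' := by
  simp only [boxF, TProg.toFunP, TProg.runF, TOp.evalF, SOp.evalF, getReg_cons_zero, getReg_cons_succ, constStack, List.map,
    Poly.eval_cons, Poly.eval_nil, add_zero, mul_zero]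
  simp only [cfSolution, UP, U0, U1, U2, U3, U4, U5, U6]
  push_cast
  ring

/-- Box obligation for the `ψ_N = 9/10` `boxF`: run accepted and upper range bound `≤ −kap`. -/
def fOK (B : PBox) (kap : ℚ) : Bool :=
  let r := boxF.pmodelP CFIterLike.QHalf.tmS 0 0 8 1 1 16 16 3 0 B []
  r.2 && decide ((tupperI CFIterLike.QHalf.tmS 0 r.1 : ℚ) ≤ -kap * (CFIterLike.QHalf.tmS : ℚ))

/-! ## §2 Records and the obligation -/

/-- Per-panel box data (`ψ_N = 9/10`; same fields as `CFIterLike.QHalf.BoxData`). -/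
structure BoxData where
  /-- panel index -/
  j : ℕ
  /-- lower end of the `θ`-range (`π⁻ · 2jh`) -/
  thlo : ℚ
  /-- upper end of the `θ`-range (`π⁺ · (2j+2)h`) -/
  thhi : ℚ
  /-- core radius `s_A` -/
  sA : ℚ
  /-- strip top `s_max` -/
  smax : ℚ
  /-- `θ`-cells of the (B1) grid -/
  ntF : ℕ
  /-- `s`-cells of the (B1) grid -/
  nsF : ℕ
  /-- `θ`-cells of the (B2) grid -/
  nt2 : ℕ
  /-- `s`-cells of the (B2) grid -/
  ns2 : ℕ
  /-- (B1) claim: `U(ray) − U_a/10 ≤ −kap` on the core -/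
  kap : ℚ
  /-- (B2) claim: `|F2c| ≤ M` on the strip -/
  M : ℚ

/-- THE PER-PANEL BOX OBLIGATION (`ψ_N = 9/10`): shape facts and every grid cell passes (`fOK` here, `CFIterLike.QHalf.f2OK`, on
`CFIterLike.QHalf.ibox`). -/
def BoxData.ok (d : BoxData) : Bool :=
  decide (0 < d.ntF) && decide (0 < d.nsF) && decide (0 < d.nt2) && decide (0 < d.ns2)
    && decide (d.thlo ≤ d.thhi) && decide (0 ≤ d.sA) && decide (d.sA ≤ d.smax) && decide (d.smax < 1)
    && (List.range d.ntF).all (fun i => (List.range d.nsF).all fun k =>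
          fOK (CFIterLike.QHalf.ibox (CFIterLike.QHalf.cell d.thlo d.thhi d.ntF i) (CFIterLike.QHalf.cell 0 d.sA d.nsF k)) d.kap)
    && (List.range d.nt2).all (fun i => (List.range d.ns2).all fun k =>
          CFIterLike.QHalf.f2OK (CFIterLike.QHalf.ibox (CFIterLike.QHalf.cell d.thlo d.thhi d.nt2 i) (CFIterLike.QHalf.cell d.sA d.smax d.ns2 k)) d.M)

/-! ## §3 Soundness -/

/-- Soundness of one (B1) box at the level `U_a/10`. -/
theorem f_le_of_fOK {B : PBox} {kap : ℚ} (h : CFIterLike.Q90.fOK B kap = true) {θ s : ℝ}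
    (hB : BoxMem [coeff 0, coeff 1, coeff 2, coeff 3, coeff 4, coeff 5, coeff 6, Xa, U Xa 0, θ, s] B) :
    PolarRay.rayProfile U Xa 0 θ s - 1 / 10 * U Xa 0 ≤ -((kap : ℚ) : ℝ) := by
  simp only [fOK, Bool.and_eq_true, decide_eq_true_eq] at h
  obtain ⟨hok, hhi⟩ := h
  have hf := TProg.tmem_pmodelP CFIterLike.QHalf.tmS_pos le_rfl 0 boxF hB [] hok
  have hS : ((CFIterLike.QHalf.tmS : ℕ) : ℚ) ≠ 0 := by exact_mod_cast CFIterLike.QHalf.tmS_pos.ne'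
  have hb := bounds_of_tmem CFIterLike.QHalf.tmS_pos le_rfl hf (lo := (tlowerI CFIterLike.QHalf.tmS 0 (boxF.pmodelP CFIterLike.QHalf.tmS 0 0 8 1 1 16 16 3 0 B []).1 : ℚ) / CFIterLike.QHalf.tmS)
    (hi := -kap) (by rw [div_mul_cancel₀ _ hS]) hhi (ρ := 0) (by simp)
  have hv := hb.2
  simp only [Rat.cast_zero, add_zero] at hv
  rw [boxF_toFunP, coeff_vec] at hv
  unfold PolarRay.rayProfile
  rw [zero_add]
  show cfSolution 0 coeff (Xa + s * Real.cos θ) (s * Real.sin θ) - 1 / 10 * cfSolution 0 coeff Xa 0 ≤ _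
  have e : U Xa 0 = cfSolution 0 coeff Xa 0 := rfl
  rw [← e]
  push_cast at hv
  exact hv

/-- **SOUNDNESS OF THE `ψ_N = 9/10` BOX OBLIGATION** of one panel: (B1) below the level on the core, (B2) `|F2c| ≤ M` on the strip. -/
theorem BoxData.sound {d : CFIterLike.Q90.BoxData} (h : d.ok = true) :
    (∀ θ ∈ Icc ((d.thlo : ℚ) : ℝ) ((d.thhi : ℚ) : ℝ), ∀ s ∈ Icc (0 : ℝ) ((d.sA : ℚ) : ℝ),
        PolarRay.rayProfile U Xa 0 θ s - 1 / 10 * U Xa 0 ≤ -((d.kap : ℚ) : ℝ))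
    ∧ (∀ θ ∈ Icc ((d.thlo : ℚ) : ℝ) ((d.thhi : ℚ) : ℝ), ∀ s ∈ Icc ((d.sA : ℚ) : ℝ) ((d.smax : ℚ) : ℝ),
        |CFIterLike.QHalf.F2c coeff Xa s θ| ≤ ((d.M : ℚ) : ℝ)) := by
  simp only [BoxData.ok, Bool.and_eq_true, decide_eq_true_eq, List.all_eq_true, List.mem_range] at h
  obtain ⟨⟨⟨⟨⟨⟨⟨⟨⟨hntF, hnsF⟩, hnt2⟩, hns2⟩, hth⟩, hsA⟩, hsAm⟩, -⟩, hF⟩, hF2⟩ := h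
  constructor
  · intro θ hθ s hs
    obtain ⟨i, hi, hθ1, hθ2⟩ := CFIterLike.QHalf.exists_cell hntF hth hθ.1 hθ.2
    have hs0 : (((0 : ℚ) : ℚ) : ℝ) ≤ s := by simpa using hs.1
    obtain ⟨k, hk, hs1, hs2⟩ := CFIterLike.QHalf.exists_cell hnsF hsA hs0 hs.2
    exact f_le_of_fOK (hF i hi k hk) (CFIterLike.QHalf.boxMem_ibox ⟨hθ1, hθ2⟩ ⟨hs1, hs2⟩)
  · intro θ hθ s hs
    obtain ⟨i, hi, hθ1, hθ2⟩ := CFIterLike.QHalf.exists_cell hnt2 hth hθ.1 hθ.2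
    obtain ⟨k, hk, hs1, hs2⟩ := CFIterLike.QHalf.exists_cell hns2 hsAm hs.1 hs.2
    exact CFIterLike.QHalf.f2_abs_of_f2OK (hF2 i hi k hk) (CFIterLike.QHalf.boxMem_ibox ⟨hθ1, hθ2⟩ ⟨hs1, hs2⟩)

end Summit.Ventures.FusionMHD.Models.CFIterLike.Q90

end
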